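import Literature.NumberTheory.EllipticCurves.DeShalit1987.KatzMeasureMonomialLines
import Mathlib.Algebra.Group.ForwardDiff
import HarnessLib

/-!
# Reading the first unit coefficient of a bounded `p`-adic power series off its values at the
# powers `u^t − 1` of one point: the FORWARD-DIFFERENCE certificate («`λ` from special values»,
# generator-free form)

Topic `NumberTheory/EllipticCurves` (receptacle `𝒪_{ℂ_p}⟦T⟧` of the tree's `p`-adic `L`-functions,
values `IntSeries.HasValueAt`). Companion of `IntSeriesValuesCertificate.lean` (dual-Vandermonde
certificate, lead seat of crux `CycTangentCM.CycTangentBound`). Along a `ℤ_p`-line of a Katz frame the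
typed interpolation points are the POWERS of one character: nodes `x_t = u^t − 1` (`u = ρ̂₁(γ)` a
principal unit, `ϖ := u − 1`), and the prescribed values come with a tame multiplicative drift `η^t`
(`η ≡ 1`, e.g. `Ω_p^{(p−1)t}`). For such data the `k`-th FORWARD DIFFERENCE with binomial weights
`D_k = Σ_{t ≤ k} (−1)^{k−t} C(k,t) η^t F(x_t)` isolates the `k`-th coefficient:

* `fwdDiffWeights_geom`: `Σ_t (−1)^{k−t} C(k,t) z^t = (z − 1)^k`; hence for `F = Σ f_j T^j`,
  `D_k = Σ_j f_j c_j` with `c_j = Σ_{i ≤ j} C(j,i)(−1)^{j−i} (u^i η − 1)^k` (`fwdDiffCoeff`);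
* `norm_fwdDiffCoeff_le`: `‖c_j‖ ≤ ‖ϖ‖^k` (each `u^iη − 1` has norm `≤ ‖ϖ‖` when `‖η − 1‖ ≤ ‖ϖ‖`);
* `norm_fwdDiffCoeff_sub_le`: `‖c_j − ϖ^k·Δ^j[r^k](c)‖ ≤ ‖ϖ‖^{k+1}` with `c = (η − 1)/ϖ`
  (`u^iη − 1 ≡ ϖ(i + c) (mod ϖ²)`), where `Δ^j[r^k](c) = 0` for `j > k` and `= k!` for `j = k`
  (Mathlib `fwdDiff_iter_pow_eq_zero_of_lt`, `fwdDiff_iter_eq_factorial`);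
* **`norm_fwdDiff_values_sub_lt`**: if `f_j ∈ 𝔪` for all `j < k` then `‖D_k − f_k·k!·ϖ^k‖ < ‖ϖ‖^k`;
* **`isUnit_coeff_iff_norm_fwdDiff_values_eq`** / **`not_isUnit_coeff_iff_…_lt`**: for `k < p`
  (`k!` a unit), under the same hypothesis, `f_k ∈ 𝒪^× ↔ ‖D_k‖ = ‖ϖ‖^k` and `f_k ∈ 𝔪 ↔ ‖D_k‖ < ‖ϖ‖^k`.

So `λ̄(F) = min{k : f_k ∈ 𝒪^×}` is certified, inductively in `k < p`, by the VALUATIONS of the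
integer combinations `D_0, …, D_k` of the values — no knowledge of the nodes beyond `‖u − 1‖` is needed
(the dual vector of the Vandermonde certificate depends on the exact nodes; the binomial weights do not).
Written for the negative road of crux `CycTangentCM.CycTangentBound` (stmt-BirchSwinnertonDyer-22628,
`Cruxes/CycTangentBound/Lines/tangent_cone_parity_falsifier.md` §2: `λ̄_N` from the Damerell numbers
`e(t)`; the drift `η^t` absorbs `Ω_p^{m_t} = Ω_p·(Ω_p^{p−1}…)^t`). THEOREMS + one plumbing def; no named
fact, no `sorry`.

References: L. Washington, *Introduction to Cyclotomic Fields*, §5.2 (power series from special values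
by finite differences), §7.2 [Washington1997]; F. Gouvêa, *p-adic Numbers*, §5.6 [Gouvea1993PadicNumbers].
-/

noncomputable section

open scoped fwdDiff
open Finset Nat
open Literature.NumberTheory.EllipticCurves.GreenbergVatsal2000

namespace Literature.NumberTheory.EllipticCurves.IntSeries

variable {p : ℕ} [Fact p.Prime]

/-! ### §1. Binomial weights and the geometric identity -/

/-- The `k`-th forward-difference weight `(−1)^{k−t} C(k,t)`, read in `ℂ_p`. [cite: Washington1997, §5.2] -/
def fwdDiffWeight (p : ℕ) [Fact p.Prime] (k t : ℕ) : ℂ_[p] := (((-1 : ℤ) ^ (k - t) * (k.choose t : ℤ) : ℤ) : ℂ_[p])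

/-- The weights are integers, of norm `≤ 1`. [cite: Washington1997, §5.2] -/
theorem norm_fwdDiffWeight_le (k t : ℕ) : ‖fwdDiffWeight p k t‖ ≤ 1 := by
  rw [fwdDiffWeight]
  have : (((-1 : ℤ) ^ (k - t) * (k.choose t : ℤ) : ℤ) : ℂ_[p]) =
      ((((-1 : ℤ) ^ (k - t) * (k.choose t : ℤ) : ℤ) : PadicComplexInt p) : ℂ_[p]) := by
    push_cast; rfl
  rw [this]
  exact norm_coe_padicComplexInt_le_one _

/-- **The geometric identity** `Σ_{t ≤ k} (−1)^{k−t} C(k,t) z^t = (z − 1)^k` (binomial theorem; the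
`k`-th forward difference of `t ↦ z^t` at `0`). [cite: Washington1997, §5.2] -/
theorem fwdDiffWeights_geom (k : ℕ) (z : ℂ_[p]) :
    ∑ t ∈ range (k + 1), fwdDiffWeight p k t * z ^ t = (z - 1) ^ k := by
  rw [sub_eq_add_neg, add_pow]
  refine sum_congr rfl fun t ht ↦ ?_
  rw [fwdDiffWeight]
  push_cast
  ring

/-! ### §2. The coefficients `c_j` of the forward difference of the values -/

/-- `c_j(u, η, k) := Σ_{i ≤ j} C(j,i)(−1)^{j−i} (u^i η − 1)^k` — the `k`-th weighted difference of
`t ↦ η^t (u^t − 1)^j`. [cite: Washington1997, §5.2] -/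
def fwdDiffCoeff (p : ℕ) [Fact p.Prime] (u η : ℂ_[p]) (k j : ℕ) : ℂ_[p] :=
  ∑ i ∈ range (j + 1), fwdDiffWeight p j i * (u ^ i * η - 1) ^ k

/-- **`Σ_t (−1)^{k−t}C(k,t) η^t (u^t − 1)^j = c_j`**: expand `(u^t − 1)^j` binomially and apply the
geometric identity to each `z = u^iη`. [cite: Washington1997, §5.2] -/
theorem sum_fwdDiffWeight_mul_pow_eq (u η : ℂ_[p]) (k j : ℕ) :
    ∑ t ∈ range (k + 1), fwdDiffWeight p k t * (η ^ t * (u ^ t - 1) ^ j) = fwdDiffCoeff p u η k j := by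
  have hexp : ∀ t : ℕ, η ^ t * (u ^ t - 1) ^ j =
      ∑ i ∈ range (j + 1), fwdDiffWeight p j i * (u ^ i * η) ^ t := by
    intro t
    rw [← fwdDiffWeights_geom j (u ^ t), mul_sum]
    refine sum_congr rfl fun i _ ↦ ?_
    rw [mul_pow, ← pow_mul, ← pow_mul, mul_comm i t]
    ring
  simp_rw [hexp, mul_sum]
  rw [sum_comm, fwdDiffCoeff]
  refine sum_congr rfl fun i _ ↦ ?_
  rw [← fwdDiffWeights_geom k (u ^ i * η), mul_sum]
  refine sum_congr rfl fun t _ ↦ ?_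
  ring

variable {u η : ℂ_[p]}

/-- `‖u^i η − 1‖ ≤ ‖u − 1‖` when `‖η − 1‖ ≤ ‖u − 1‖ ≤ 1`. [cite: Gouvea1993PadicNumbers, §5.6] -/
theorem norm_pow_mul_sub_one_le (hϖ1 : ‖u - 1‖ ≤ 1) (hη : ‖η - 1‖ ≤ ‖u - 1‖) (i : ℕ) :
    ‖u ^ i * η - 1‖ ≤ ‖u - 1‖ := by
  have hu : ‖u‖ ≤ 1 := by
    have := IsUltrametricDist.norm_add_le_max (u - 1) 1
    rw [sub_add_cancel, norm_one] at this
    exact this.trans (max_le hϖ1 le_rfl)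
  have hui : ‖u ^ i - 1‖ ≤ ‖u - 1‖ := by
    induction i with
    | zero => simp
    | succ n ih =>
      have h1 : u ^ (n + 1) - 1 = u * (u ^ n - 1) + (u - 1) := by ring
      rw [h1]
      refine (IsUltrametricDist.norm_add_le_max _ _).trans (max_le ?_ le_rfl)
      rw [norm_mul]
      exact (mul_le_mul hu ih (norm_nonneg _) zero_le_one).trans (by rw [one_mul])
  have h2 : u ^ i * η - 1 = u ^ i * (η - 1) + (u ^ i - 1) := by ring
  rw [h2]
  refine (IsUltrametricDist.norm_add_le_max _ _).trans (max_le ?_ hui)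
  rw [norm_mul, norm_pow]
  exact (mul_le_mul (pow_le_one₀ (norm_nonneg _) hu) hη (norm_nonneg _) zero_le_one).trans
    (by rw [one_mul])

/-- **`‖c_j‖ ≤ ‖u − 1‖^k`** (ultrametric sum of integer multiples of `k`-th powers of elements of norm
`≤ ‖u − 1‖`). [cite: Washington1997, §5.2] -/
theorem norm_fwdDiffCoeff_le (hϖ1 : ‖u - 1‖ ≤ 1) (hη : ‖η - 1‖ ≤ ‖u - 1‖) (k j : ℕ) :
    ‖fwdDiffCoeff p u η k j‖ ≤ ‖u - 1‖ ^ k := by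
  refine IsUltrametricDist.norm_sum_le_of_forall_le_of_nonneg (pow_nonneg (norm_nonneg _) _)
    fun i _ ↦ ?_
  rw [norm_mul, norm_pow]
  exact (mul_le_mul (norm_fwdDiffWeight_le j i) (pow_le_pow_left₀ (norm_nonneg _)
    (norm_pow_mul_sub_one_le hϖ1 hη i) k) (pow_nonneg (norm_nonneg _) _) zero_le_one).trans
    (by rw [one_mul])

/-- `u^i η − 1 ≡ (u − 1)(i + c)` modulo `(u − 1)²`, `c = (η − 1)/(u − 1)`:
`‖(u^iη − 1) − (i(u−1) + (η − 1))‖ ≤ ‖u − 1‖²`. [cite: Gouvea1993PadicNumbers, §5.6] -/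
theorem norm_pow_mul_sub_one_sub_linear_le (hϖ1 : ‖u - 1‖ ≤ 1) (hη : ‖η - 1‖ ≤ ‖u - 1‖) (i : ℕ) :
    ‖(u ^ i * η - 1) - ((i : ℂ_[p]) * (u - 1) + (η - 1))‖ ≤ ‖u - 1‖ ^ 2 := by
  -- `u^i − 1 − i(u−1) = (u−1)² · (integer polynomial in u)`: by induction
  have hu : ‖u‖ ≤ 1 := by
    have := IsUltrametricDist.norm_add_le_max (u - 1) 1
    rw [sub_add_cancel, norm_one] at this
    exact this.trans (max_le hϖ1 le_rfl)
  have hquad : ∀ n : ℕ, ‖u ^ n - 1 - (n : ℂ_[p]) * (u - 1)‖ ≤ ‖u - 1‖ ^ 2 := by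
    intro n
    induction n with
    | zero => simp
    | succ n ih =>
      have h1 : u ^ (n + 1) - 1 - ((n + 1 : ℕ) : ℂ_[p]) * (u - 1) =
          u * (u ^ n - 1 - (n : ℂ_[p]) * (u - 1)) + (n : ℂ_[p]) * (u - 1) * (u - 1) := by
        push_cast; ring
      rw [h1]
      refine (IsUltrametricDist.norm_add_le_max _ _).trans (max_le ?_ ?_)
      · rw [norm_mul]
        exact (mul_le_mul hu ih (norm_nonneg _) zero_le_one).trans (by rw [one_mul])
      · rw [norm_mul, norm_mul, sq]
        have hn : ‖(n : ℂ_[p])‖ ≤ 1 := by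
          have : ((n : ℕ) : ℂ_[p]) = (((n : ℕ) : PadicComplexInt p) : ℂ_[p]) := by simp
          rw [this]; exact norm_coe_padicComplexInt_le_one _
        calc ‖(n : ℂ_[p])‖ * ‖u - 1‖ * ‖u - 1‖ ≤ 1 * ‖u - 1‖ * ‖u - 1‖ := by gcongr
          _ = ‖u - 1‖ * ‖u - 1‖ := by rw [one_mul]
  have h2 : (u ^ i * η - 1) - ((i : ℂ_[p]) * (u - 1) + (η - 1)) =
      (u ^ i - 1 - (i : ℂ_[p]) * (u - 1)) + (u ^ i - 1) * (η - 1) := by ring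
  rw [h2]
  refine (IsUltrametricDist.norm_add_le_max _ _).trans (max_le (hquad i) ?_)
  rw [norm_mul, sq]
  have hui : ‖u ^ i - 1‖ ≤ ‖u - 1‖ := by
    have := norm_pow_mul_sub_one_le hϖ1 (η := 1) (by simp) i
    simpa using this
  exact mul_le_mul hui hη (norm_nonneg _) (norm_nonneg _)

/-- `‖a^{k+1} − b^{k+1}‖ ≤ ‖a − b‖ · r^k` for `‖a‖, ‖b‖ ≤ r` (ultrametric;
`a^{k+1} − b^{k+1} = a(a^k − b^k) + (a − b)b^k`). [cite: Gouvea1993PadicNumbers, §5.6] -/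
theorem norm_pow_sub_pow_le {a b : ℂ_[p]} {r : ℝ} (ha : ‖a‖ ≤ r) (hb : ‖b‖ ≤ r) (k : ℕ) :
    ‖a ^ (k + 1) - b ^ (k + 1)‖ ≤ ‖a - b‖ * r ^ k := by
  have hr0 : 0 ≤ r := (norm_nonneg a).trans ha
  induction k with
  | zero => simp
  | succ k ih =>
    have h1 : a ^ (k + 2) - b ^ (k + 2) = a * (a ^ (k + 1) - b ^ (k + 1)) + (a - b) * b ^ (k + 1) := by ring
    rw [show k + 1 + 1 = k + 2 from rfl, h1]
    refine (IsUltrametricDist.norm_add_le_max _ _).trans (max_le ?_ ?_)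
    · rw [norm_mul, pow_succ]
      calc ‖a‖ * ‖a ^ (k + 1) - b ^ (k + 1)‖ ≤ r * (‖a - b‖ * r ^ k) :=
            mul_le_mul ha ih (norm_nonneg _) hr0
        _ = ‖a - b‖ * (r ^ k * r) := by ring
    · rw [norm_mul, norm_pow]
      exact mul_le_mul_of_nonneg_left (pow_le_pow_left₀ (norm_nonneg _) hb _) (norm_nonneg _)

/-- **The fine structure of `c_j`**: `‖c_j − (u−1)^k · Δ^j[r ↦ r^k](c)‖ ≤ ‖u − 1‖^{k+1}`, where
`c = (η − 1)/(u − 1)` and `Δ^j[r^k](c) = Σ_{i ≤ j} (−1)^{j−i} C(j,i) (c + i)^k` is the `j`-th forward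
difference of the monomial `r^k` at `c` (Mathlib `fwdDiff_iter_eq_sum_shift`).
[cite: Washington1997, §5.2] -/
theorem norm_fwdDiffCoeff_sub_le (hϖ0 : u - 1 ≠ 0) (hϖ1 : ‖u - 1‖ ≤ 1) (hη : ‖η - 1‖ ≤ ‖u - 1‖)
    (k j : ℕ) :
    ‖fwdDiffCoeff p u η k j -
        (u - 1) ^ k * (fwdDiff (1 : ℂ_[p]))^[j] (fun r : ℂ_[p] ↦ r ^ k) ((η - 1) / (u - 1))‖ ≤
      ‖u - 1‖ ^ (k + 1) := by
  -- the model terms `W_i = (u−1) (c + i) = i (u−1) + (η − 1)`, `c = (η−1)/(u−1)`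
  have hW : ∀ i : ℕ, (u - 1) * ((η - 1) / (u - 1) + i) = (i : ℂ_[p]) * (u - 1) + (η - 1) := by
    intro i
    field_simp
    ring
  rw [fwdDiff_iter_eq_sum_shift, fwdDiffCoeff, mul_sum, ← sum_sub_distrib]
  refine IsUltrametricDist.norm_sum_le_of_forall_le_of_nonneg (pow_nonneg (norm_nonneg _) _)
    fun i _ ↦ ?_
  have hwt : (((-1 : ℤ) ^ (j - i) * (j.choose i : ℕ) : ℤ) : ℂ_[p]) = fwdDiffWeight p j i := by
    rw [fwdDiffWeight]
  rw [zsmul_eq_mul, hwt, nsmul_eq_mul, mul_one, ← mul_assoc, mul_comm ((u - 1) ^ k), mul_assoc,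
    ← mul_sub, ← mul_pow, hW i, norm_mul]
  refine (mul_le_mul (norm_fwdDiffWeight_le j i) le_rfl (norm_nonneg _) zero_le_one).trans ?_
  rw [one_mul]
  -- `‖Z^k − W^k‖ ≤ ‖Z − W‖ · ‖u−1‖^{k-1} ≤ ‖u−1‖² · ‖u−1‖^{k−1}`
  cases k with
  | zero => simp
  | succ k =>
    have hZ : ‖u ^ i * η - 1‖ ≤ ‖u - 1‖ := norm_pow_mul_sub_one_le hϖ1 hη i
    have hWn : ‖(i : ℂ_[p]) * (u - 1) + (η - 1)‖ ≤ ‖u - 1‖ := by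
      refine (IsUltrametricDist.norm_add_le_max _ _).trans (max_le ?_ hη)
      rw [norm_mul]
      have hn : ‖(i : ℂ_[p])‖ ≤ 1 := by
        have : ((i : ℕ) : ℂ_[p]) = (((i : ℕ) : PadicComplexInt p) : ℂ_[p]) := by simp
        rw [this]; exact norm_coe_padicComplexInt_le_one _
      exact (mul_le_mul hn le_rfl (norm_nonneg _) zero_le_one).trans (by rw [one_mul])
    refine (norm_pow_sub_pow_le hZ hWn k).trans ?_
    have hd := norm_pow_mul_sub_one_sub_linear_le hϖ1 hη i
    calc ‖u ^ i * η - 1 - ((i : ℂ_[p]) * (u - 1) + (η - 1))‖ * ‖u - 1‖ ^ k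
        ≤ ‖u - 1‖ ^ 2 * ‖u - 1‖ ^ k := mul_le_mul_of_nonneg_right hd (pow_nonneg (norm_nonneg _) _)
      _ = ‖u - 1‖ ^ (k + 1 + 1) := by ring

/-- `c_j` for `j > k` is `O((u−1)^{k+1})`: the `j`-th difference of the degree-`k` monomial vanishes
(Mathlib `fwdDiff_iter_pow_eq_zero_of_lt`). [cite: Washington1997, §5.2] -/
theorem norm_fwdDiffCoeff_le_of_lt (hϖ0 : u - 1 ≠ 0) (hϖ1 : ‖u - 1‖ ≤ 1) (hη : ‖η - 1‖ ≤ ‖u - 1‖)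
    {k j : ℕ} (hkj : k < j) : ‖fwdDiffCoeff p u η k j‖ ≤ ‖u - 1‖ ^ (k + 1) := by
  have h := norm_fwdDiffCoeff_sub_le hϖ0 hϖ1 hη k j
  rwa [fwdDiff_iter_pow_eq_zero_of_lt hkj, Pi.zero_apply, mul_zero, sub_zero] at h

/-- `c_k = k!·(u−1)^k + O((u−1)^{k+1})` (Mathlib `fwdDiff_iter_eq_factorial`). [cite: Washington1997, §5.2] -/
theorem norm_fwdDiffCoeff_sub_factorial_le (hϖ0 : u - 1 ≠ 0) (hϖ1 : ‖u - 1‖ ≤ 1)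
    (hη : ‖η - 1‖ ≤ ‖u - 1‖) (k : ℕ) :
    ‖fwdDiffCoeff p u η k k - (k ! : ℂ_[p]) * (u - 1) ^ k‖ ≤ ‖u - 1‖ ^ (k + 1) := by
  have h := norm_fwdDiffCoeff_sub_le hϖ0 hϖ1 hη k k
  rw [fwdDiff_iter_eq_factorial] at h
  have hk : ((k ! : ℂ_[p] → ℂ_[p]) ((η - 1) / (u - 1))) = ((k ! : ℕ) : ℂ_[p]) := rfl
  rw [hk, mul_comm] at h
  exact_mod_cast h

/-- Ultrametric: a finite sum of terms of norm `< r` (`r > 0`) has norm `< r`. [folklore] -/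
private theorem norm_sum_lt_of_forall_lt {ι : Type*} {s : Finset ι} {f : ι → ℂ_[p]} {r : ℝ}
    (hr : 0 < r) (h : ∀ i ∈ s, ‖f i‖ < r) : ‖∑ i ∈ s, f i‖ < r := by
  classical
  induction s using Finset.induction_on with
  | empty => simpa using hr
  | insert a s ha ih =>
    rw [sum_insert ha]
    exact lt_of_le_of_lt (IsUltrametricDist.norm_add_le_max _ _)
      (max_lt (h a (mem_insert_self a s)) (ih fun i hi ↦ h i (mem_insert_of_mem hi)))

/-! ### §3. The forward difference of the values and the certificate -/

/-- **`D_k = Σ_j f_j c_j`**: the weighted difference of the drifted values `η^t F(u^t − 1)` is the series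
`Σ_j [T^j]F · c_j` (finite combination of absolutely convergent evaluations). [cite: Washington1997, §5.2] -/
theorem hasSum_coeff_mul_fwdDiffCoeff (F : PowerSeries (PadicComplexInt p)) (hϖ : ‖u - 1‖ < 1)
    (η : ℂ_[p]) (k : ℕ) {v : ℕ → ℂ_[p]}
    (hv : ∀ t, t ≤ k → IntSeries.HasValueAt F (u ^ t - 1) (v t)) :
    HasSum (fun j : ℕ ↦ ((PowerSeries.coeff j F : PadicComplexInt p) : ℂ_[p]) * fwdDiffCoeff p u η k j)
      (∑ t ∈ range (k + 1), fwdDiffWeight p k t * (η ^ t * v t)) := by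
  have hx : ∀ t : ℕ, ‖u ^ t - 1‖ < 1 := fun t ↦ by
    have := norm_pow_mul_sub_one_le hϖ.le (η := 1) (by simp) t
    rw [mul_one] at this
    exact this.trans_lt hϖ
  -- each value as a HasSum, scaled by the weight and the drift
  have hterm : ∀ t ∈ range (k + 1), HasSum (fun j : ℕ ↦ fwdDiffWeight p k t * (η ^ t *
      (((PowerSeries.coeff j F : PadicComplexInt p) : ℂ_[p]) * (u ^ t - 1) ^ j)))
      (fwdDiffWeight p k t * (η ^ t * v t)) := by
    intro t ht
    exact ((hv t (by rw [mem_range] at ht; omega)).mul_left (η ^ t)).mul_left (fwdDiffWeight p k t)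
  have hsum := hasSum_sum hterm
  refine hsum.congr_fun fun j ↦ ?_
  rw [← sum_fwdDiffWeight_mul_pow_eq, mul_sum]
  refine sum_congr rfl fun t _ ↦ ?_
  ring

/-- **Main estimate.** If `[T^j]F ∈ 𝔪` for all `j < k`, then with `ϖ = u − 1` (`0 < ‖ϖ‖ < 1`,
`‖η − 1‖ ≤ ‖ϖ‖`): `‖D_k − [T^k]F · k! · ϖ^k‖ < ‖ϖ‖^k`. [cite: Washington1997, §5.2 (Thm. 5.11, proof)] -/
theorem norm_fwdDiff_values_sub_lt (F : PowerSeries (PadicComplexInt p)) (hϖ0 : u - 1 ≠ 0)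
    (hϖ : ‖u - 1‖ < 1) (hη : ‖η - 1‖ ≤ ‖u - 1‖) {k : ℕ}
    (hlow : ∀ j, j < k → ¬ IsUnit (PowerSeries.coeff j F)) {v : ℕ → ℂ_[p]}
    (hv : ∀ t, t ≤ k → IntSeries.HasValueAt F (u ^ t - 1) (v t)) :
    ‖∑ t ∈ range (k + 1), fwdDiffWeight p k t * (η ^ t * v t) -
        ((PowerSeries.coeff k F : PadicComplexInt p) : ℂ_[p]) * ((k ! : ℂ_[p]) * (u - 1) ^ k)‖ <
      ‖u - 1‖ ^ k := by
  set ϖ := u - 1 with hϖ_def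
  have hϖpos : 0 < ‖ϖ‖ := norm_pos_iff.mpr hϖ0
  have hS := hasSum_coeff_mul_fwdDiffCoeff F hϖ η k hv
  -- split off the terms `j ≤ k`
  set f : ℕ → ℂ_[p] := fun j ↦ ((PowerSeries.coeff j F : PadicComplexInt p) : ℂ_[p]) *
    fwdDiffCoeff p u η k j with hf_def
  have htail : HasSum (fun j : ℕ ↦ f (j + (k + 1)))
      (∑ t ∈ range (k + 1), fwdDiffWeight p k t * (η ^ t * v t) - ∑ j ∈ range (k + 1), f j) :=
    (hasSum_nat_add_iff' (k + 1)).mpr hS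
  have htail_le : ‖∑ t ∈ range (k + 1), fwdDiffWeight p k t * (η ^ t * v t) - ∑ j ∈ range (k + 1), f j‖
      ≤ ‖ϖ‖ ^ (k + 1) := by
    rw [← htail.tsum_eq]
    refine IsUltrametricDist.norm_tsum_le_of_forall_le_of_nonneg (pow_nonneg (norm_nonneg _) _)
      fun j ↦ ?_
    rw [hf_def]
    dsimp only
    rw [norm_mul]
    exact (mul_le_mul (norm_coe_padicComplexInt_le_one _)
      (norm_fwdDiffCoeff_le_of_lt hϖ0 hϖ.le hη (by omega)) (norm_nonneg _) zero_le_one).trans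
      (by rw [one_mul])
  -- the terms `j < k` are `< ‖ϖ‖^k`, the term `j = k` is `f_k k! ϖ^k + O(ϖ^{k+1})`
  have hlt : ‖ϖ‖ ^ (k + 1) < ‖ϖ‖ ^ k := pow_lt_pow_right_of_lt_one₀ hϖpos hϖ (lt_add_one k)
  have hhead : ‖∑ j ∈ range k, f j‖ < ‖ϖ‖ ^ k := by
    refine norm_sum_lt_of_forall_lt (pow_pos hϖpos k) fun j hj ↦ ?_
    rw [mem_range] at hj
    have hfj : ‖((PowerSeries.coeff j F : PadicComplexInt p) : ℂ_[p])‖ < 1 :=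
      lt_of_le_of_ne (norm_coe_padicComplexInt_le_one _)
        (fun h ↦ hlow j hj (isUnit_padicComplexInt_iff.mpr h))
    rw [hf_def]
    dsimp only
    rw [norm_mul]
    calc ‖((PowerSeries.coeff j F : PadicComplexInt p) : ℂ_[p])‖ * ‖fwdDiffCoeff p u η k j‖
        ≤ ‖((PowerSeries.coeff j F : PadicComplexInt p) : ℂ_[p])‖ * ‖ϖ‖ ^ k :=
          mul_le_mul_of_nonneg_left (norm_fwdDiffCoeff_le hϖ.le hη k j) (norm_nonneg _)
      _ < 1 * ‖ϖ‖ ^ k := mul_lt_mul_of_pos_right hfj (pow_pos hϖpos k)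
      _ = ‖ϖ‖ ^ k := one_mul _
  have hmid : ‖f k - ((PowerSeries.coeff k F : PadicComplexInt p) : ℂ_[p]) * ((k ! : ℂ_[p]) * ϖ ^ k)‖
      < ‖ϖ‖ ^ k := by
    rw [hf_def]
    dsimp only
    rw [← mul_sub, norm_mul]
    refine lt_of_le_of_lt ?_ hlt
    exact (mul_le_mul (norm_coe_padicComplexInt_le_one _)
      (norm_fwdDiffCoeff_sub_factorial_le hϖ0 hϖ.le hη k) (norm_nonneg _) zero_le_one).trans
      (by rw [one_mul])
  have hdecomp : ∑ t ∈ range (k + 1), fwdDiffWeight p k t * (η ^ t * v t) -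
      ((PowerSeries.coeff k F : PadicComplexInt p) : ℂ_[p]) * ((k ! : ℂ_[p]) * ϖ ^ k) =
      (∑ t ∈ range (k + 1), fwdDiffWeight p k t * (η ^ t * v t) - ∑ j ∈ range (k + 1), f j) +
        (∑ j ∈ range k, f j +
          (f k - ((PowerSeries.coeff k F : PadicComplexInt p) : ℂ_[p]) * ((k ! : ℂ_[p]) * ϖ ^ k))) := by
    rw [Finset.sum_range_succ f k]; ring
  rw [hdecomp]
  refine lt_of_le_of_lt (IsUltrametricDist.norm_add_le_max _ _) (max_lt (htail_le.trans_lt hlt) ?_)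
  exact lt_of_le_of_lt (IsUltrametricDist.norm_add_le_max _ _) (max_lt hhead hmid)

/-- `‖k!‖ = 1` in `ℂ_p` for `k < p`. [cite: Gouvea1993PadicNumbers, §5.6] -/
theorem norm_natCast_factorial_eq_one {k : ℕ} (hk : k < p) : ‖((k ! : ℕ) : ℂ_[p])‖ = 1 := by
  have hp : p.Prime := Fact.out
  have h1 : ((k ! : ℕ) : ℂ_[p]) = (((k ! : ℕ) : ℚ_[p]) : ℂ_[p]) := by simp
  rw [h1, PadicComplex.norm_extends', Padic.norm_natCast_eq_one_iff]
  exact (Nat.Prime.coprime_iff_not_dvd hp).mpr fun h ↦ absurd (hp.dvd_factorial.mp h) (not_le.mpr hk)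

/-- **The certificate, unit case**: for `k < p` and `[T^j]F ∈ 𝔪` (`j < k`), `[T^k]F` is a UNIT iff the
weighted difference of the drifted values has norm EXACTLY `‖u − 1‖^k`.
[cite: Washington1997, §5.2 (Thm. 5.11, proof)] -/
theorem isUnit_coeff_iff_norm_fwdDiff_values_eq (F : PowerSeries (PadicComplexInt p)) (hϖ0 : u - 1 ≠ 0)
    (hϖ : ‖u - 1‖ < 1) (hη : ‖η - 1‖ ≤ ‖u - 1‖) {k : ℕ} (hk : k < p)
    (hlow : ∀ j, j < k → ¬ IsUnit (PowerSeries.coeff j F)) {v : ℕ → ℂ_[p]}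
    (hv : ∀ t, t ≤ k → IntSeries.HasValueAt F (u ^ t - 1) (v t)) :
    IsUnit (PowerSeries.coeff k F) ↔
      ‖∑ t ∈ range (k + 1), fwdDiffWeight p k t * (η ^ t * v t)‖ = ‖u - 1‖ ^ k := by
  have hmain := norm_fwdDiff_values_sub_lt F hϖ0 hϖ hη hlow hv
  set D := ∑ t ∈ range (k + 1), fwdDiffWeight p k t * (η ^ t * v t) with hD
  set a := ((PowerSeries.coeff k F : PadicComplexInt p) : ℂ_[p]) * ((k ! : ℂ_[p]) * (u - 1) ^ k) with ha
  have hfact : ‖(k ! : ℂ_[p])‖ = 1 := by exact_mod_cast norm_natCast_factorial_eq_one (p := p) hk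
  have hna : ‖a‖ = ‖((PowerSeries.coeff k F : PadicComplexInt p) : ℂ_[p])‖ * ‖u - 1‖ ^ k := by
    rw [ha, norm_mul, norm_mul, hfact, one_mul, norm_pow]
  have hDa : D = a + (D - a) := by ring
  rw [isUnit_padicComplexInt_iff]
  constructor
  · intro hu1
    rw [hu1, one_mul] at hna
    rw [hDa, IsUltrametricDist.norm_add_eq_max_of_norm_ne_norm (by rw [hna]; exact hmain.ne'),
      hna, max_eq_left hmain.le]
  · intro hDn
    by_contra hne
    have hlt1 : ‖((PowerSeries.coeff k F : PadicComplexInt p) : ℂ_[p])‖ < 1 :=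
      lt_of_le_of_ne (norm_coe_padicComplexInt_le_one _) hne
    have ha_lt : ‖a‖ < ‖u - 1‖ ^ k := by
      rw [hna]
      calc ‖((PowerSeries.coeff k F : PadicComplexInt p) : ℂ_[p])‖ * ‖u - 1‖ ^ k
          < 1 * ‖u - 1‖ ^ k := mul_lt_mul_of_pos_right hlt1 (pow_pos (norm_pos_iff.mpr hϖ0) k)
        _ = ‖u - 1‖ ^ k := one_mul _
    have : ‖D‖ < ‖u - 1‖ ^ k := by
      rw [hDa]
      exact lt_of_le_of_lt (IsUltrametricDist.norm_add_le_max _ _) (max_lt ha_lt hmain)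
    exact this.ne hDn

/-- **The certificate, non-unit case**: under the same hypotheses `[T^k]F ∈ 𝔪` iff the weighted
difference has norm `< ‖u − 1‖^k` (all values involved have norm `≤ ‖u−1‖^k` anyway).
[cite: Washington1997, §5.2 (Thm. 5.11, proof)] -/
theorem not_isUnit_coeff_iff_norm_fwdDiff_values_lt (F : PowerSeries (PadicComplexInt p))
    (hϖ0 : u - 1 ≠ 0) (hϖ : ‖u - 1‖ < 1) (hη : ‖η - 1‖ ≤ ‖u - 1‖) {k : ℕ} (hk : k < p)
    (hlow : ∀ j, j < k → ¬ IsUnit (PowerSeries.coeff j F)) {v : ℕ → ℂ_[p]}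
    (hv : ∀ t, t ≤ k → IntSeries.HasValueAt F (u ^ t - 1) (v t)) :
    ¬ IsUnit (PowerSeries.coeff k F) ↔
      ‖∑ t ∈ range (k + 1), fwdDiffWeight p k t * (η ^ t * v t)‖ < ‖u - 1‖ ^ k := by
  have hmain := norm_fwdDiff_values_sub_lt F hϖ0 hϖ hη hlow hv
  rw [isUnit_coeff_iff_norm_fwdDiff_values_eq F hϖ0 hϖ hη hk hlow hv]
  set D := ∑ t ∈ range (k + 1), fwdDiffWeight p k t * (η ^ t * v t) with hD
  set a := ((PowerSeries.coeff k F : PadicComplexInt p) : ℂ_[p]) * ((k ! : ℂ_[p]) * (u - 1) ^ k) with ha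
  have hfact : ‖(k ! : ℂ_[p])‖ = 1 := by exact_mod_cast norm_natCast_factorial_eq_one (p := p) hk
  have hle : ‖D‖ ≤ ‖u - 1‖ ^ k := by
    have hDa : D = a + (D - a) := by ring
    rw [hDa]
    refine (IsUltrametricDist.norm_add_le_max _ _).trans (max_le ?_ hmain.le)
    rw [ha, norm_mul, norm_mul, hfact, one_mul, norm_pow]
    exact (mul_le_mul (norm_coe_padicComplexInt_le_one _) le_rfl (pow_nonneg (norm_nonneg _) _)
      zero_le_one).trans (by rw [one_mul])
  constructor
  · intro h; exact lt_of_le_of_ne hle h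
  · intro h; exact h.ne

end Literature.NumberTheory.EllipticCurves.IntSeries
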